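import Mathlib
import HarnessLib
import Summits.HubbardSuperconductivity.HubbardSuperconductivity.Theorems.KLProgrammeMatsubaraSliceBubbleTransfer
import Literature.Analysis.FunctionSpaces.WeakCompactnessL1Proofs

/-!
# Route `KLProgramme` — crux K3 split, ENGINE child (`KLRegimeEngineV11` stmt-HubbardSuperconductivity-19823): the slice-bubble estimates with the
# insertion `W` and the energy shift `δ` only known ON THE ENERGY WINDOW `[−4Λ_n, 4Λ_n]` (cell gate-hubbard-kl, seat hubbard-kl-k3c2-p2)

The zero-transfer/thermal estimate `klte_slice_bubble_weighted_norm_le` and the transfer estimate `klsp_slice_bubble_transfer_norm_le` ask for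
`W` (resp. `δ`) CONTINUOUS ON ℝ (and `|δ| ≤ δ_max` everywhere).  On the carrier these are the level-set Jacobian `𝒥_E(θ, ·)` and the shifted energy
`δ_θ(e) = e_K(u_E(μ+e,θ)·dir θ + q) − e`, which are only defined (continuous, bounded) on the admissible energy window — outside it
`perturbedFermiRadius` is junk.  Since the slice weight kills the integrand for `|e| ≥ 4Λ_n` anyway, continuity / bounds ON `[−4Λ_n, 4Λ_n]` suffice:
this module re-states both estimates with `ContinuousOn W (Icc (−4Λ_n) (4Λ_n))`, `ContinuousOn δ (Icc (−4Λ_n) (4Λ_n))` and the shift bound on the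
window only (`klsw_slice_bubble_weighted_norm_le`, `klsw_slice_bubble_transfer_norm_le`), by clamping `e` to the window inside `W` and `δ`
(clamp `e ↦ max (−r) (min r e)`; the integrands agree pointwise).  Pure analysis.
-/

noncomputable section

namespace Summit.HubbardSuperconductivity.HubbardSuperconductivity.Theorems.KLRegimeSplit

set_option linter.dupNamespace false -- summit = problem name (single-conjunct summit), D-0017

open Real Set MeasureTheory Complex Literature.MathematicalPhysics.QuantumLattice Literature.Probability.LatticeModels
open Summit.HubbardSuperconductivity.HubbardSuperconductivity.Theorems.KLProgrammeLegKernels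

/-! ## §1 Clamping to a window (the map `e ↦ max (−r) (min r e)`; no new definition) -/

/-- The clamp `e ↦ max (−r) (min r e)` is continuous. -/
theorem klsw_continuous_clamp (r : ℝ) : Continuous fun e : ℝ => max (-r) (min r e) := by
  fun_prop

/-- The clamp lands in the window (`r ≥ 0`; the tree's `abs_max_neg_min_le`). -/
theorem klsw_clamp_mem {r : ℝ} (hr : 0 ≤ r) (e : ℝ) : max (-r) (min r e) ∈ Icc (-r) r :=
  abs_le.mp (Literature.Analysis.FunctionSpaces.abs_max_neg_min_le hr e)

/-- A function continuous on the window becomes continuous on ℝ after clamping its argument. -/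
theorem klsw_continuous_comp_clamp {X : Type*} [TopologicalSpace X] {g : ℝ → X} {r : ℝ} (hr : 0 ≤ r)
    (hg : ContinuousOn g (Icc (-r) r)) : Continuous fun e => g (max (-r) (min r e)) :=
  hg.comp_continuous (klsw_continuous_clamp r) (klsw_clamp_mem hr)

/-! ## §2 The estimates with window hypotheses -/

section Window

variable {F f f' : ℝ → ℂ} {LF MF ℓ Mf Lf' Mf' ℓ' : ℝ} {W : ℝ → ℂ} {δ : ℝ → ℝ} {LW BW δmax : ℝ}

/-- Off the window the shell weight vanishes: `F(k₀² + e²) = 0` for `|e| ≥ 4Λ` when `F(s) = 0` for `s ≥ (4Λ)²`. -/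
theorem klsw_weight_zero_of_le_abs {Λ : ℝ} (hΛ : 0 ≤ Λ) (hout : ∀ s, (4 * Λ) ^ 2 ≤ s → F s = 0) (k₀ : ℝ) {e : ℝ}
    (he : 4 * Λ ≤ |e|) : F (k₀ ^ 2 + e ^ 2) = 0 := by
  apply hout
  nlinarith [sq_abs e, sq_nonneg k₀, abs_nonneg e]

/-- **`klte_slice_bubble_weighted_norm_le` with the insertion only continuous ON THE WINDOW `[−4Λ_n, 4Λ_n]`.** -/
theorem klsw_slice_bubble_weighted_norm_le (hMF : 0 ≤ MF) (hlip : ∀ s s', ‖F s - F s'‖ ≤ LF * |s - s'|) (hbd : ∀ s, ‖F s‖ ≤ MF)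
    {n : ℕ} (hLF : LF ≤ ℓ / klScale klE0 n ^ 2)
    (hin : ∀ s, s ≤ (klScale klE0 n / 2) ^ 2 → F s = 0) (hout : ∀ s, (4 * klScale klE0 n) ^ 2 ≤ s → F s = 0)
    (hW : ContinuousOn W (Icc (-(4 * klScale klE0 n)) (4 * klScale klE0 n))) (hLW : 0 ≤ LW) (hBW : 0 ≤ BW)
    (hWlip : ∀ e : ℝ, |e| < 4 * klScale klE0 n → ‖W e - W 0‖ ≤ LW * |e|)
    (hWbd : ∀ e : ℝ, |e| < 4 * klScale klE0 n → ‖W e‖ ≤ BW)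
    {β : ℝ} (hβ : klBetaMin ≤ β) (hn : n ≤ nScales β + 1) {M : ℕ}
    (hM : β * (4 * klScale klE0 n) / (2 * Real.pi) + 1 ≤ M) :
    ‖β⁻¹ • ∑ i : MatsubaraIdx M,
        ∫ e : ℝ, F (matsubaraFreq β M i ^ 2 + e ^ 2) * ((-I * (matsubaraFreq β M i) + e) ^ 2)⁻¹ * W e‖ ≤
      524288 / Real.pi * (ℓ + 8 * MF) * LW * klScale klE0 n +
        393216 / Real.pi * (ℓ + 8 * MF) * BW * ((Real.pi / β) / klScale klE0 n) := by
  set r := 4 * klScale klE0 n with hr_def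
  have hr : 0 ≤ r := by have := klth_klScale_pos n; positivity
  set W' : ℝ → ℂ := fun e => W (max (-r) (min r e)) with hW'
  have hW'c : Continuous W' := klsw_continuous_comp_clamp hr hW
  have hW'eq : ∀ e, |e| < r → W' e = W e := fun e he => by simp only [hW', Literature.Analysis.FunctionSpaces.max_neg_min_eq_self he.le]
  have hW'0 : W' 0 = W 0 := by simp only [hW', Literature.Analysis.FunctionSpaces.max_neg_min_eq_self (show |(0:ℝ)| ≤ r by simpa using hr)]
  have hW'lip : ∀ e : ℝ, |e| < r → ‖W' e - W' 0‖ ≤ LW * |e| := fun e he => by rw [hW'eq e he, hW'0]; exact hWlip e he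
  have hW'bd : ∀ e : ℝ, |e| < r → ‖W' e‖ ≤ BW := fun e he => by rw [hW'eq e he]; exact hWbd e he
  -- the integrands agree pointwise
  have hpt : ∀ (k₀ e : ℝ), F (k₀ ^ 2 + e ^ 2) * ((-I * k₀ + e) ^ 2)⁻¹ * W e = F (k₀ ^ 2 + e ^ 2) * ((-I * k₀ + e) ^ 2)⁻¹ * W' e := by
    intro k₀ e
    by_cases he : |e| < r
    · rw [hW'eq e he]
    · rw [klsw_weight_zero_of_le_abs (by linarith [klth_klScale_pos n]) hout k₀ (not_lt.mp he), zero_mul, zero_mul, zero_mul]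
  simp_rw [hpt]
  exact klte_slice_bubble_weighted_norm_le hMF hlip hbd hLF hin hout hW'c hLW hBW hW'lip hW'bd hβ hn hM

/-- **`klsp_slice_bubble_transfer_norm_le` with the insertion and the energy shift only known ON THE WINDOW `[−4Λ_n, 4Λ_n]`**
(`W`, `δ` continuous there, `|δ| ≤ δ_max` there). -/
theorem klsw_slice_bubble_transfer_norm_le {Lf LWr : ℝ}
    (hlip : ∀ s s', ‖f s - f s'‖ ≤ Lf * |s - s'|) (hbd : ∀ s, ‖f s‖ ≤ Mf) {n : ℕ}
    (hin : ∀ s, s ≤ (klScale klE0 n / 2) ^ 2 → f s = 0) (hout : ∀ s, (4 * klScale klE0 n) ^ 2 ≤ s → f s = 0)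
    (hlip' : ∀ s s', ‖f' s - f' s'‖ ≤ Lf' * |s - s'|) (hbd' : ∀ s, ‖f' s‖ ≤ Mf') (hLf' : Lf' ≤ ℓ' / klScale klE0 n ^ 2)
    (hin' : ∀ s, s ≤ (klScale klE0 n / 2) ^ 2 → f' s = 0) (hout' : ∀ s, (4 * klScale klE0 n) ^ 2 ≤ s → f' s = 0)
    (hMF : 0 ≤ MF) (hFlip : ∀ s s', ‖f s * f' s - f s' * f' s'‖ ≤ LF * |s - s'|) (hFbd : ∀ s, ‖f s * f' s‖ ≤ MF)
    (hLF : LF ≤ ℓ / klScale klE0 n ^ 2)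
    (hW : ContinuousOn W (Icc (-(4 * klScale klE0 n)) (4 * klScale klE0 n))) (hLW : 0 ≤ LWr) (hBW : 0 ≤ BW)
    (hWlip : ∀ e : ℝ, |e| < 4 * klScale klE0 n → ‖W e - W 0‖ ≤ LWr * |e|)
    (hWbd : ∀ e, |e| < 4 * klScale klE0 n → ‖W e‖ ≤ BW)
    (hδc : ContinuousOn δ (Icc (-(4 * klScale klE0 n)) (4 * klScale klE0 n))) (hδ0 : 0 ≤ δmax)
    (hδ : ∀ e, |e| ≤ 4 * klScale klE0 n → |δ e| ≤ δmax)
    (q₀ : ℝ) {β : ℝ} (hβ : klBetaMin ≤ β) (hn : n ≤ nScales β + 1) {M : ℕ}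
    (hM : β * (4 * klScale klE0 n) / (2 * Real.pi) + 1 ≤ M) :
    ‖β⁻¹ • ∑ i : MatsubaraIdx M, ∫ e,
        W e * (f (matsubaraFreq β M i ^ 2 + e ^ 2) / (((matsubaraFreq β M i ^ 2 + e ^ 2 : ℝ)) : ℂ) * (I * (matsubaraFreq β M i) + e)) *
          (f' ((matsubaraFreq β M i + q₀) ^ 2 + (e + δ e) ^ 2) / ((((matsubaraFreq β M i + q₀) ^ 2 + (e + δ e) ^ 2 : ℝ)) : ℂ) *
              (I * ((matsubaraFreq β M i + q₀ : ℝ) : ℂ) + ((e + δ e : ℝ) : ℂ)))‖ ≤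
      524288 / Real.pi * (ℓ + 8 * MF) * LWr * klScale klE0 n +
        393216 / Real.pi * (ℓ + 8 * MF) * BW * ((Real.pi / β) / klScale klE0 n) +
          1024 / Real.pi * Mf * (48 * ℓ' + 193 * Mf') * BW * (|q₀| + δmax) / klScale klE0 n := by
  set r := 4 * klScale klE0 n with hr_def
  have hΛ := klth_klScale_pos n
  have hr : 0 ≤ r := by positivity
  set W' : ℝ → ℂ := fun e => W (max (-r) (min r e)) with hW'
  set δ' : ℝ → ℝ := fun e => δ (max (-r) (min r e)) with hδ'
  have hW'c : Continuous W' := klsw_continuous_comp_clamp hr hW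
  have hδ'c : Continuous δ' := klsw_continuous_comp_clamp hr hδc
  have hW'eq : ∀ e, |e| < r → W' e = W e := fun e he => by simp only [hW', Literature.Analysis.FunctionSpaces.max_neg_min_eq_self he.le]
  have hδ'eq : ∀ e, |e| < r → δ' e = δ e := fun e he => by simp only [hδ', Literature.Analysis.FunctionSpaces.max_neg_min_eq_self he.le]
  have hW'0 : W' 0 = W 0 := by simp only [hW', Literature.Analysis.FunctionSpaces.max_neg_min_eq_self (show |(0:ℝ)| ≤ r by simpa using hr)]
  have hW'lip : ∀ e : ℝ, |e| < r → ‖W' e - W' 0‖ ≤ LWr * |e| := fun e he => by rw [hW'eq e he, hW'0]; exact hWlip e he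
  have hW'bd : ∀ e : ℝ, |e| < r → ‖W' e‖ ≤ BW := fun e he => by rw [hW'eq e he]; exact hWbd e he
  have hδ'bd : ∀ e, |δ' e| ≤ δmax := by
    intro e
    have hm := klsw_clamp_mem hr e
    exact hδ _ (abs_le.mpr ⟨hm.1, hm.2⟩)
  -- the integrands agree pointwise (the first propagator vanishes off the window)
  have hΦzero : ∀ (k₀ e : ℝ), r ≤ |e| →
      f (k₀ ^ 2 + e ^ 2) / (((k₀ ^ 2 + e ^ 2 : ℝ)) : ℂ) * (I * k₀ + e) = 0 := by
    intro k₀ e he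
    rw [klsw_weight_zero_of_le_abs hΛ.le hout k₀ he, zero_div, zero_mul]
  have hpt : ∀ (k₀ e : ℝ),
      W e * (f (k₀ ^ 2 + e ^ 2) / (((k₀ ^ 2 + e ^ 2 : ℝ)) : ℂ) * (I * k₀ + e)) *
          (f' ((k₀ + q₀) ^ 2 + (e + δ e) ^ 2) / ((((k₀ + q₀) ^ 2 + (e + δ e) ^ 2 : ℝ)) : ℂ) *
            (I * ((k₀ + q₀ : ℝ) : ℂ) + ((e + δ e : ℝ) : ℂ))) =
        W' e * (f (k₀ ^ 2 + e ^ 2) / (((k₀ ^ 2 + e ^ 2 : ℝ)) : ℂ) * (I * k₀ + e)) *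
          (f' ((k₀ + q₀) ^ 2 + (e + δ' e) ^ 2) / ((((k₀ + q₀) ^ 2 + (e + δ' e) ^ 2 : ℝ)) : ℂ) *
            (I * ((k₀ + q₀ : ℝ) : ℂ) + ((e + δ' e : ℝ) : ℂ))) := by
    intro k₀ e
    by_cases he : |e| < r
    · rw [hW'eq e he, hδ'eq e he]
    · rw [hΦzero k₀ e (not_lt.mp he), mul_zero, zero_mul, mul_zero, zero_mul]
  simp_rw [hpt]
  exact klsp_slice_bubble_transfer_norm_le hlip hbd hin hout hlip' hbd' hLf' hin' hout' hMF hFlip hFbd hLF hW'c hLW hBW hW'lip hW'bd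
    hδ'c hδ0 hδ'bd q₀ hβ hn hM

end Window

end Summit.HubbardSuperconductivity.HubbardSuperconductivity.Theorems.KLRegimeSplit

end
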